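import Literature.AlgebraicGeometry.AbelianSchemes.AbelianSchemeKOfLLocal
import Literature.AlgebraicGeometry.AbelianSchemes.AbelianSchemeTheoremOfCubeLocallyNoetherian
import Literature.AlgebraicGeometry.AbelianSchemes.AbelianSchemeOverZariskiGluingLevel
import Literature.AlgebraicGeometry.Modules.PullbackFrame
import Literature.AlgebraicGeometry.Modules.DetClassOfIso
import HarnessLib

/-!
# `K(L)` commutes with base change: membership, representing subscheme, rigidification and exponent

Layer `Literature/AlgebraicGeometry/AbelianSchemes`, namespace `Literature.AlgebraicGeometry.AbelianSchemes.AbelianSchemeOver`.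
THEOREMS ONLY (no definition, no named fact, no instance, no notation, no `sorry`).  Cell `hodgecm-mathlib` (D-0151),
FLOOR-0 programme P1, F-3 child line (M) `Cruxes/HDel/Lines/F3DualAbelianSchemeM`, letter (Ma) ed. 4 (the `K′`-clause is
stated for the base change `A ×_R S′` and `L′ := L|_{A ×_R S′}` while the (K) output `K(L)` lives over `Spec R`).  Author
B-p19 (g18); count-neutral capital.  HC_CM is proved only modulo the 7 printed citations until rung 0 closes; nothing here
is about HC.

## What is proved ([MumfordAV1970] §13; [GortzWedhorn2020] (4.15) «`(G ×_S S′)_{S′}(T) = G_S(T)`»)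

For a base-change square of group schemes `G : A′ → A` over `g : S′ → S` (★ `IsBaseChangeVia`), `L` of rank one on `A`
and `L′ := G^*L`:
* `IsBaseChangeVia.pullback_whiskerLeft_left_mumfordClass_pullback` — the class of `(1 × u′)^*Λ(L′)` on `A′ ×_{S′} T′`
  is the Mumford class of `L` pulled back along `(x′G, (u′ ∘ pr)G)` (★ `IsBaseChangeVia.pullback_lift_left_mumfordClass_pullback`);
* **`IsBaseChangeVia.memKOfL_pullback_iff`** — `u′ ∈ K(L′)(T′) ↔ u′G ∈ K(L)(T′)` (`T′` viewed over `S` through `g`;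
  ★ `pushHom`): `K(G^*L) = K(L) ×_S S′` on points — the comparison `A′ ×_{S′} T′ ≅ A ×_S T′` is split by an explicit
  section, so the class is trivial on one side iff on the other;
* **`IsBaseChangeVia.exists_represents_memKOfL_pullback`** — if `K(L)` is represented by a closed immersion `i : Z ↪ A`
  with `Z → S` étale, then `K(L′)` is represented by `Z ×_A A′ ↪ A′`, a closed immersion, étale over `S′` (pasting of
  pullback squares, Mathlib `IsPullback.paste_vert`);
* `IsBaseChangeVia.pullback_unitSection_detClass_pullback_eq_one` — the rigidification `ε^*[L] = 1` transfers to `L′`;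
* `IsBaseChangeVia.pow_eq_one_of_memKOfL_pullback` — if `i ^ n = 1` (★-in-HOME (T3) of the (K) hand) then every
  `T′`-point of `K(L′)` is `n`-torsion (`pushHom` is an injective homomorphism, ★ `pushHomMulEquiv`).

## References
* [MumfordAV1970] D. Mumford, *Abelian Varieties* (1970), §13 (p. 123).
* [GortzWedhorn2020] U. Görtz, T. Wedhorn, *Algebraic Geometry I*, 2nd ed. (2020), Section (4.15) (p. 116), Def. 4.42.
* [MumfordFogartyKirwan1994] D. Mumford, J. Fogarty, F. Kirwan, *Geometric Invariant Theory*, 3rd ed. (1994), Ch. 6 §2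
  Definition 6.2 (p. 120), (p. 121).
-/

noncomputable section

universe u

open CategoryTheory CategoryTheory.Limits AlgebraicGeometry MonoidalCategory CartesianMonoidalCategory

open scoped MonObj Obj

namespace Literature.AlgebraicGeometry.AbelianSchemes

open Literature.AlgebraicGeometry.Modules Literature.AlgebraicGeometry.Motives Literature.AlgebraicGeometry.AbelianVarieties

namespace AbelianSchemeOver

variable {S S' : Scheme.{u}} {A' : AbelianSchemeOver S'} {A : AbelianSchemeOver S} {g : S' ⟶ S}
  {G : A'.X.left ⟶ A.X.left}

/-- **`Λ` of `G^*c` along `1 × u′` is `Λ` of `c` along `(pr_{A′}G, (u′ ∘ pr_{T′})G)`** for a base-change square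
`G : A′ → A` of group schemes ([MumfordFogartyKirwan1994] Ch. 6 §2: `Λ(x,y) = (x·y)^*L ⊗ x^*L⁻¹ ⊗ y^*L⁻¹` and `G` is a
homomorphism on points). [cite: MumfordFogartyKirwan1994, Ch. 6 §2 Definition 6.2 (p. 120)]
[cite: GortzWedhorn2020, Section (4.15) (p. 116)] -/
theorem IsBaseChangeVia.pullback_whiskerLeft_left_mumfordClass_pullback (h : A'.IsBaseChangeVia A g G)
    (c : CechPic A.left) {T' : Over S'} (u' : T' ⟶ A'.X) :
    CechPic.pullback (A'.X ◁ u').left (A'.mumfordClass (CechPic.pullback G c)) =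
      CechPic.pullback (lift (h.pushHom (fst A'.X T')) (h.pushHom (snd A'.X T' ≫ u'))).left (A.mumfordClass c) := by
  have hw : A'.X ◁ u' = lift (fst A'.X T') (snd A'.X T' ≫ u') :=
    CartesianMonoidalCategory.hom_ext _ _ (by rw [whiskerLeft_fst, lift_fst]) (by rw [whiskerLeft_snd, lift_snd])
  rw [hw]
  exact h.pullback_lift_left_mumfordClass_pullback c (fst A'.X T') (snd A'.X T' ≫ u')

/-- **`K(L)` commutes with base change on points**: for `G : A′ → A` over `g : S′ → S` a base-change square of group
schemes, `L` of rank one on `A` and an `S′`-point `u′ : T′ → A′`: `u′ ∈ K(G^*L)(T′)` iff `u′G ∈ K(L)(T′)`, where `T′` is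
viewed over `S` through `g` (★ `pushHom`) — [GortzWedhorn2020] (4.15) «`(G ×_S S′)_{S′}(T) = G_S(T)`» applied to the
subgroup functor `K(L)` of [MumfordAV1970] §13.  (The two classes live on `A′ ×_{S′} T′` and `A ×_S T′`; the comparison
map has a section, so one is trivial iff the other is.) [cite: MumfordAV1970, §13 (p. 123)]
[cite: GortzWedhorn2020, Section (4.15) (p. 116)] -/
theorem IsBaseChangeVia.memKOfL_pullback_iff (h : A'.IsBaseChangeVia A g G) {L : A.left.Modules} (hL : HasRank L 1)
    {T' : Over S'} (u' : T' ⟶ A'.X) :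
    A'.MemKOfL ((Scheme.Modules.pullback G).obj L) u' ↔ A.MemKOfL L (h.pushHom u') := by
  have hL' : HasRank ((Scheme.Modules.pullback G).obj L) 1 := hasRank_pullback G hL
  have hc : detClass (HasRank.isFiniteLocallyFree' hL') =
      CechPic.pullback G (detClass (HasRank.isFiniteLocallyFree' hL)) :=
    detClass_pullback (f := G) (HasRank.isFiniteLocallyFree' hL)
  rw [A'.memKOfL_iff_mumfordClass hL', A.memKOfL_iff_mumfordClass hL, hc,
    h.pullback_whiskerLeft_left_mumfordClass_pullback]
  -- the comparison `κ : A′ ×_{S′} T′ → A ×_S T′` over `S`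
  let Tg : Over S := Over.mk (T'.hom ≫ g)
  have hsw : (snd A'.X T').left ≫ Tg.hom = (Over.mk ((A'.X ⊗ T').hom ≫ g)).hom := by
    change (snd A'.X T').left ≫ T'.hom ≫ g = (A'.X ⊗ T').hom ≫ g
    rw [← Category.assoc, Over.w (snd A'.X T')]
  let sndg : Over.mk ((A'.X ⊗ T').hom ≫ g) ⟶ Tg := Over.homMk (snd A'.X T').left hsw
  have hsnd : sndg ≫ h.pushHom u' = h.pushHom (snd A'.X T' ≫ u') :=
    Over.OverMorphism.ext (by
      change (snd A'.X T').left ≫ (u'.left ≫ G) = (snd A'.X T' ≫ u').left ≫ G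
      rw [Over.comp_left, Category.assoc])
  have hκ : lift (h.pushHom (fst A'.X T')) (h.pushHom (snd A'.X T' ≫ u')) =
      lift (h.pushHom (fst A'.X T')) sndg ≫ (A.X ◁ h.pushHom u') := by
    rw [lift_whiskerLeft, hsnd]
  -- a section `λ : A ×_S T′ → A′ ×_{S′} T′` of `κ`
  have hsq := h.snd.1
  have wa : (fst A.X Tg).left ≫ A.X.hom = ((snd A.X Tg).left ≫ T'.hom) ≫ g := by
    rw [Category.assoc]
    exact (Over.w (fst A.X Tg)).trans (Over.w (snd A.X Tg)).symm
  let a : (A.X ⊗ Tg).left ⟶ A'.X.left := hsq.lift (fst A.X Tg).left ((snd A.X Tg).left ≫ T'.hom) wa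
  have ha₁ : a ≫ G = (fst A.X Tg).left := hsq.lift_fst _ _ _
  have ha₂ : a ≫ A'.X.hom = (snd A.X Tg).left ≫ T'.hom := hsq.lift_snd _ _ _
  let lamL : (A.X ⊗ Tg).left ⟶ pullback A'.X.hom T'.hom := pullback.lift a (snd A.X Tg).left ha₂
  have hlam1 : lamL ≫ pullback.fst A'.X.hom T'.hom = a := pullback.lift_fst _ _ _
  have hlam2 : lamL ≫ pullback.snd A'.X.hom T'.hom = (snd A.X Tg).left := pullback.lift_snd _ _ _
  have hlam : lamL ≫ (Over.mk ((A'.X ⊗ T').hom ≫ g)).hom = (A.X ⊗ Tg).hom := by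
    change lamL ≫ (pullback.fst A'.X.hom T'.hom ≫ A'.X.hom) ≫ g = (A.X ⊗ Tg).hom
    calc lamL ≫ (pullback.fst A'.X.hom T'.hom ≫ A'.X.hom) ≫ g
        = (lamL ≫ pullback.fst A'.X.hom T'.hom) ≫ (A'.X.hom ≫ g) := by simp only [Category.assoc]
      _ = a ≫ (G ≫ A.X.hom) := by rw [hlam1, h.fst]
      _ = (fst A.X Tg).left ≫ A.X.hom := by rw [← Category.assoc, ha₁]
      _ = (A.X ⊗ Tg).hom := Over.w (fst A.X Tg)
  let lam : A.X ⊗ Tg ⟶ Over.mk ((A'.X ⊗ T').hom ≫ g) := Over.homMk lamL hlam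
  have hsec : lam ≫ lift (h.pushHom (fst A'.X T')) sndg = 𝟙 (A.X ⊗ Tg) := by
    refine CartesianMonoidalCategory.hom_ext _ _ ?_ ?_
    · rw [Category.assoc, lift_fst, Category.id_comp]
      exact Over.OverMorphism.ext (by
        change lamL ≫ (pullback.fst A'.X.hom T'.hom ≫ G) = (fst A.X Tg).left
        rw [← Category.assoc, hlam1, ha₁])
    · rw [Category.assoc, lift_snd, Category.id_comp]
      exact Over.OverMorphism.ext (by
        change lamL ≫ pullback.snd A'.X.hom T'.hom = (snd A.X Tg).left
        exact hlam2)
  rw [hκ, Over.comp_left, CechPic.pullback_comp]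
  constructor
  · intro H
    have H' := congrArg (CechPic.pullback lam.left) H
    rw [← CechPic.pullback_comp, ← Over.comp_left, hsec, Over.id_left, CechPic.pullback_id_apply] at H'
    exact H'.trans (map_one _)
  · intro H
    rw [H]
    exact map_one _

/-- **The rigidification transfers**: `ε_{A′}^*[G^*L] = g^*(ε_A^*[L]) = 1` (unit clause of ★ `IsBaseChangeVia`).
[cite: MumfordFogartyKirwan1994, Ch. 6 §2 (p. 121)] [cite: GortzWedhorn2020, Section (4.15) (p. 116)] -/
theorem IsBaseChangeVia.pullback_unitSection_detClass_pullback_eq_one (h : A'.IsBaseChangeVia A g G)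
    {L : A.left.Modules} (hL : HasRank L 1)
    (hε : CechPic.pullback A.unitSection (detClass (HasRank.isFiniteLocallyFree' hL)) = 1) :
    CechPic.pullback A'.unitSection (detClass (HasRank.isFiniteLocallyFree' (hasRank_pullback G hL))) = 1 := by
  have hc : detClass (HasRank.isFiniteLocallyFree' (hasRank_pullback G hL)) =
      CechPic.pullback G (detClass (HasRank.isFiniteLocallyFree' hL)) :=
    detClass_pullback (f := G) (HasRank.isFiniteLocallyFree' hL)
  have hη : A'.unitSection ≫ G = g ≫ A.unitSection := h.snd.2.1
  rw [hc, ← CechPic.pullback_comp, hη, CechPic.pullback_comp, hε, map_one]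

/-- **`K(L′) = K(L) ×_A A′` is represented**: if `K(L)` is represented by a closed immersion `i : Z ↪ A` with `Z → S`
étale, then `K(G^*L)` is represented by the base change `Z ×_A A′ ↪ A′`, again a closed immersion with `Z ×_A A′ → S′`
étale (the pasted square `Z ×_A A′ → Z` over `S′ → S` is cartesian, Mathlib `IsPullback.paste_vert`).
[cite: MumfordAV1970, §13 (p. 123)] [cite: GortzWedhorn2020, Section (4.15) (p. 116)] -/
theorem IsBaseChangeVia.exists_represents_memKOfL_pullback (h : A'.IsBaseChangeVia A g G) {L : A.left.Modules}
    (hL : HasRank L 1) {Z : Over S} (i : Z ⟶ A.X) [IsClosedImmersion i.left] [Etale Z.hom]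
    (hZ : ∀ (T : Over S) (u : T ⟶ A.X), (∃ v : T ⟶ Z, v ≫ i = u) ↔ A.MemKOfL L u) :
    ∃ (Z' : Over S') (i' : Z' ⟶ A'.X) (_ : IsClosedImmersion i'.left) (_ : Etale Z'.hom),
      ∀ (T' : Over S') (u' : T' ⟶ A'.X),
        (∃ v' : T' ⟶ Z', v' ≫ i' = u') ↔ A'.MemKOfL ((Scheme.Modules.pullback G).obj L) u' := by
  let Z' : Over S' := Over.mk (pullback.snd i.left G ≫ A'.X.hom)
  let i' : Z' ⟶ A'.X := Over.homMk (pullback.snd i.left G) rfl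
  haveI : IsClosedImmersion i'.left := by
    change IsClosedImmersion (pullback.snd i.left G); infer_instance
  -- the two projections of `Z ×_A A′`, typed on `Z'.left`
  let fZ : Z'.left ⟶ Z.left := pullback.fst i.left G
  have hcond : fZ ≫ i.left = i'.left ≫ G := pullback.condition
  -- `Z ×_A A′ → S′` is the base change of `Z → S` along `g`
  have hsq : IsPullback fZ Z'.hom Z.hom g := by
    have h1 : IsPullback fZ i'.left i.left G := IsPullback.of_hasPullback i.left G
    have h2 : IsPullback G A'.X.hom A.X.hom g := h.snd.1
    have h12 := h1.paste_vert h2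
    rw [Over.w i] at h12
    exact h12
  haveI : Etale Z'.hom := MorphismProperty.IsStableUnderBaseChange.of_isPullback hsq inferInstance
  refine ⟨Z', i', inferInstance, inferInstance, fun T' u' => ?_⟩
  rw [h.memKOfL_pullback_iff hL, ← hZ]
  constructor
  · rintro ⟨v', hv'⟩
    have hvS : (v'.left ≫ fZ) ≫ Z.hom = (Over.mk (T'.hom ≫ g)).hom := by
      change (v'.left ≫ fZ) ≫ Z.hom = T'.hom ≫ g
      rw [Category.assoc, hsq.w, ← Category.assoc, Over.w v']
    refine ⟨Over.homMk (v'.left ≫ fZ) hvS, Over.OverMorphism.ext ?_⟩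
    change (v'.left ≫ fZ) ≫ i.left = u'.left ≫ G
    rw [Category.assoc, hcond, ← Category.assoc, ← Over.comp_left, hv']
  · rintro ⟨v, hv⟩
    have hvl : v.left ≫ i.left = u'.left ≫ G := congrArg (fun f : Over.mk (T'.hom ≫ g) ⟶ A.X => f.left) hv
    let v'L : T'.left ⟶ Z'.left := pullback.lift v.left u'.left hvl
    have hv'L : v'L ≫ i'.left = u'.left := pullback.lift_snd _ _ _
    have hvS : v'L ≫ Z'.hom = T'.hom := by
      change v'L ≫ i'.left ≫ A'.X.hom = T'.hom
      rw [← Category.assoc, hv'L]; exact Over.w u'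
    exact ⟨Over.homMk v'L hvS, Over.OverMorphism.ext hv'L⟩

/-- **Exponent transfer**: if `i ^ n = 1` for the representing `i : Z ↪ A` of `K(L)` (the (K) hand's (T3): a finite
unramified subgroup scheme is killed by an integer), then every point of `K(G^*L)` is `n`-torsion — `u′ ∈ K(G^*L)` means
`u′G = v ≫ i` for some `v`, so `(u′G)^n = v ≫ i^n = 1`, and `u′ ↦ u′G` is an injective homomorphism (★ `pushHomMulEquiv`).
[cite: MumfordAV1970, §13 (p. 123)] [cite: GortzWedhorn2020, Section (4.15) (p. 116) and Definition 4.42 (p. 116)] -/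
theorem IsBaseChangeVia.pow_eq_one_of_memKOfL_pullback (h : A'.IsBaseChangeVia A g G) {L : A.left.Modules}
    (hL : HasRank L 1) {Z : Over S} (i : Z ⟶ A.X)
    (hZ : ∀ (T : Over S) (u : T ⟶ A.X), (∃ v : T ⟶ Z, v ≫ i = u) ↔ A.MemKOfL L u) {n : ℕ} (hin : i ^ n = 1)
    {T' : Over S'} (u' : T' ⟶ A'.X) (hu' : A'.MemKOfL ((Scheme.Modules.pullback G).obj L) u') : u' ^ n = 1 := by
  obtain ⟨v, hv⟩ := (hZ _ _).2 ((h.memKOfL_pullback_iff hL u').1 hu')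
  have hφ : (v ≫ i) ^ n = v ≫ i ^ n :=
    ((MonoidHom.mk' (fun f : Z ⟶ A.X => v ≫ f) (MonObj.comp_mul v)).map_pow i n).symm
  have hpow : h.pushHom u' ^ n = 1 := by
    rw [← hv, hφ, hin, MonObj.comp_one]
  apply (h.pushHomMulEquiv T').injective
  rw [map_pow, map_one, IsBaseChangeVia.pushHomMulEquiv_apply, hpow]

end AbelianSchemeOver

end Literature.AlgebraicGeometry.AbelianSchemes

end
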